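import Mathlib
import Summits.NavierStokesRegularity.NavierStokesRegularity.Theorems.TaoLadderRungTwoBreakOneShiftWindowTermFieldJets
import HarnessLib

/-!
# The one-shift window system, XXIV: the VARIATIONAL JET RECURSION of a term-list field — the derivatives
# `DΦ_k` of the flow Taylor coefficient maps satisfy the linearised Cauchy-product recursion (the real-side target
# of the replay's variational jets `W_q` / p1's `varMatLevelsA`) (cell harvest/h2-tao-ladder, seat p2;
# rung1/KERNEL-CHEAP-REPLAY-SPEC.md §2 (e), §7 (R2); support for K1(1) = `NoSurvivingDSSOne`, stmt-NavierStokesRegularity-20205)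

MODEL lattice ODEs only (Tao 2016 §4 normal form on Tao's shift set `S`); nothing here is a statement about
the Navier–Stokes equations; no item is closed; nothing numerical is proved. Generic in `ι`, `κ`.

Part XXIII proved the state jet recursion `(k+1) Φ_{k+1} = Σ coef · (jet fa ⋆ jet fb)_k` for `Φ_k = tjet T k` (the
Lie–Taylor maps of `Literature.Analysis.ODE.SmoothFieldTaylorCoefficients`). Differentiating it in `x` (both sides
are smooth; derivatives are unique) gives the recursion for `DΦ_k = smoothTaylorFDeriv`, i.e. for the entries
`EV_j ∋ DΦ_j(W)` and `AK ∋ DΦ_K(S)` that the C¹ enclosure theorem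
`Literature.Analysis.ODE.hasFDerivWithinAt_flow_of_variationalEnclosure` consumes:

* `vjet T k x v := smoothTaylorFDeriv (termField T) k x v`, `hasFDerivAt_tjet`, `vjet_zero` (`DΦ_0 = Id`);
* `Factor.djetVal` / `Factor.dCLM` — the derivative of a factor's jet (the state variational jet for a coordinate,
  `0` for an external value), `Factor.hasFDerivAt_jetVal`;
* `vjet_succ` — **`(k+1) · DΦ_{k+1}(x)[v]_i = Σ_terms [out = i] coef · Σ_{p+q=k} (Djet(fa)_p[v] · jet(fb)_q +
  jet(fa)_p · Djet(fb)_q[v])`**.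
-/

noncomputable section

-- the sub-problem namespace repeats the summit name by design (D-0017)
set_option linter.dupNamespace false

namespace Summit.NavierStokesRegularity.NavierStokesRegularity.Theorems

namespace DSSOneShift

open Set Metric Literature.Analysis.ODE TopologicalSpace
open scoped ContDiff

variable {ι : Type*} [Fintype ι] [DecidableEq ι] {κ : Type*} [Fintype κ]

/-- **The derivative of the flow Taylor coefficient map**: `vjet T k x v = DΦ_k(x)[v]`. [cite: HairerWannerLubich2002, §III.5.1 eq. (5.4); WalawskaWilczak2016, §1.1] -/
def vjet (T : κ → BTerm ι) (k : ℕ) (x v : ι → ℝ) : ι → ℝ :=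
  smoothTaylorFDeriv (Ω := ⊤) (termField_contDiffOn T) k x v

/-- `Φ_k` has derivative `DΦ_k` everywhere. [cite: HairerWannerLubich2002, §III.5.1 eq. (5.4)] -/
theorem hasFDerivAt_tjet (T : κ → BTerm ι) (k : ℕ) (x : ι → ℝ) :
    HasFDerivAt (tjet T k) (smoothTaylorFDeriv (Ω := ⊤) (termField_contDiffOn T) k x) x :=
  hasFDerivAt_smoothTaylorMap _ k (Opens.mem_top x)

/-- `DΦ_0 = Id`. [folklore] -/
theorem vjet_zero (T : κ → BTerm ι) (x v : ι → ℝ) : vjet T 0 x v = v := by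
  have h1 : HasFDerivAt (tjet T 0) (smoothTaylorFDeriv (Ω := ⊤) (termField_contDiffOn T) 0 x) x :=
    hasFDerivAt_tjet T 0 x
  have h2 : HasFDerivAt (tjet T 0) (ContinuousLinearMap.id ℝ (ι → ℝ)) x := by
    have : tjet T 0 = id := funext fun y => tjet_zero T y
    rw [this]; exact hasFDerivAt_id x
  have := h1.unique h2
  simp only [vjet, this, ContinuousLinearMap.id_apply]

namespace Factor

/-- The derivative of a factor's jet: the variational jet for a coordinate, `0` for an external value. [folklore] -/
def djetVal (T : κ → BTerm ι) (φ : Factor ι) (p : ℕ) (x v : ι → ℝ) : ℝ :=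
  match φ with
  | coord c => vjet T p x v c
  | ext _ => 0

/-- The same as a continuous linear map. [folklore] -/
def dCLM (T : κ → BTerm ι) (φ : Factor ι) (p : ℕ) (x : ι → ℝ) : (ι → ℝ) →L[ℝ] ℝ :=
  match φ with
  | coord c => (ContinuousLinearMap.proj c).comp (smoothTaylorFDeriv (Ω := ⊤) (termField_contDiffOn T) p x)
  | ext _ => 0

/-- Unfolding. [folklore] -/
@[simp] theorem dCLM_apply (T : κ → BTerm ι) (φ : Factor ι) (p : ℕ) (x v : ι → ℝ) :
    φ.dCLM T p x v = φ.djetVal T p x v := by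
  cases φ with
  | coord c => rfl
  | ext e => rfl

/-- A factor's jet is differentiable in the state with the declared derivative. [folklore] -/
theorem hasFDerivAt_jetVal (T : κ → BTerm ι) (φ : Factor ι) (p : ℕ) (x : ι → ℝ) :
    HasFDerivAt (fun y => φ.jetVal T p y) (φ.dCLM T p x) x := by
  cases φ with
  | coord c => exact (hasFDerivAt_pi'.1 (hasFDerivAt_tjet T p x)) c
  | ext e => exact hasFDerivAt_const _ _

end Factor

/-- **THE VARIATIONAL JET RECURSION.** For `f = termField T` and every `x`, `v`, `i`, `k`:
`(k+1) · DΦ_{k+1}(x)[v]_i = Σ_terms [out = i] coef · Σ_{p+q=k} (Djet(fa)_p(x)[v] · jet(fb)_q(x) + jet(fa)_p(x) · Djet(fb)_q(x)[v])`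
— the recursion the replay's variational jets evaluate in interval arithmetic over boxes (SPEC §2 (e)); with
`vjet_zero` it determines all `DΦ_k`. [cite: WalawskaWilczak2016, §1.1 (ψ^[i]); Moore1979, §3.4 eqs. (3.17)–(3.18)] -/
theorem vjet_succ (T : κ → BTerm ι) (k : ℕ) (x v : ι → ℝ) (i : ι) :
    ((k : ℝ) + 1) * vjet T (k + 1) x v i =
      ∑ t, (T t).coefAt i * ∑ pq ∈ Finset.HasAntidiagonal.antidiagonal k,
        ((T t).fa.djetVal T pq.1 x v * (T t).fb.jetVal T pq.2 x +
          (T t).fa.jetVal T pq.1 x * (T t).fb.djetVal T pq.2 x v) := by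
  -- derivative of the left side of the state recursion
  have hL : HasFDerivAt (fun y => ((k : ℝ) + 1) * tjet T (k + 1) y i)
      (((k : ℝ) + 1) • (ContinuousLinearMap.proj i).comp
        (smoothTaylorFDeriv (Ω := ⊤) (termField_contDiffOn T) (k + 1) x)) x :=
    ((hasFDerivAt_pi'.1 (hasFDerivAt_tjet T (k + 1) x)) i).const_mul _
  -- derivative of the right side
  set R' : (ι → ℝ) →L[ℝ] ℝ := ∑ t, (T t).coefAt i •
      ∑ pq ∈ Finset.HasAntidiagonal.antidiagonal k,
        ((T t).fa.jetVal T pq.1 x • (T t).fb.dCLM T pq.2 x + (T t).fb.jetVal T pq.2 x • (T t).fa.dCLM T pq.1 x)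
    with hR'
  have hR : HasFDerivAt (fun y => ∑ t, (T t).coefAt i * ∑ pq ∈ Finset.HasAntidiagonal.antidiagonal k,
      (T t).fa.jetVal T pq.1 y * (T t).fb.jetVal T pq.2 y) R' x := by
    rw [hR']
    refine HasFDerivAt.fun_sum fun t _ => ?_
    refine HasFDerivAt.const_mul (HasFDerivAt.fun_sum fun pq _ => ?_) _
    exact ((T t).fa.hasFDerivAt_jetVal T pq.1 x).fun_mul ((T t).fb.hasFDerivAt_jetVal T pq.2 x)
  -- the two functions coincide (part XXIII), hence so do their derivatives
  have hR2 : HasFDerivAt (fun y => ((k : ℝ) + 1) * tjet T (k + 1) y i) R' x :=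
    hR.congr_of_eventuallyEq (Filter.Eventually.of_forall fun y => tjet_succ T k y i)
  have huniq := congrArg (fun L : (ι → ℝ) →L[ℝ] ℝ => L v) (hL.unique hR2)
  simp only [FunLike.coe_smul, Pi.smul_apply, ContinuousLinearMap.comp_apply, ContinuousLinearMap.proj_apply,
    smul_eq_mul] at huniq
  rw [show vjet T (k + 1) x v i = smoothTaylorFDeriv (Ω := ⊤) (termField_contDiffOn T) (k + 1) x v i from rfl,
    huniq, hR']
  simp only [FunLike.coe_sum, Finset.sum_apply, FunLike.coe_smul, Pi.smul_apply, add_apply, Factor.dCLM_apply,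
    smul_eq_mul]
  refine Finset.sum_congr rfl fun t _ => ?_
  congr 1
  exact Finset.sum_congr rfl fun pq _ => by ring

end DSSOneShift

end Summit.NavierStokesRegularity.NavierStokesRegularity.Theorems
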